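import Summits.QuantumFields.YangMills.Theorems.BalabanLadderIRDefectSquaringSharp
import Summits.QuantumFields.YangMills.Theorems.BalabanLadderIRColdPurityBridgeRungs
import HarnessLib

/-!
# Line `fss-handover` (ideator ym-ir-idea-11 g0, lens «finite»: reduction-to-finite — theorem first, computation second)
## crux `BalabanLadder.IR` (stmt-QuantumFields-19354, rung R2c) — the β-UNIFORMITY of the infrared leg carried by ONE
## finite-size-scaling universality statement; the Yang–Mills content left as DECIDABLE INSTANCES

HONEST FRAMING.  Nothing in this file proves the Yang–Mills mass gap (Clay) or the crux `IR`; R4 (`BalabanUVStability4`)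
closes only the conditional finite-𝕋⁴ rung `BalabanLadder.UV`.  This is a conditional skeleton: five `stub_*` obligations
(three new typed Props + the pincer's `AFToColdPressure` and the flux-sector residual `IRnsc` BY NAME) and a kernel-checked
composition `IR_of` concluding `Summit.QuantumFields.YangMills.Theses.BalabanLadder.IR` by name.  The seam
`coldPressureOnsetSC_of_handover` is PROVED here (sorry-free) over the tree's landed aspect-ratio bootstrap in its SHARP
unconditional form (`AspectBootstrap.coldDefect_sq_le_two_pow`, C = 2²⁰, basin 2⁻²⁴; rev 1 used `defectSquaring` with
C = `squaringConst`).

REV 2 (after ym-ir-crit-3 VERDICT-fss-handover = PASS-WITH-PRICE, P1–P5; honest restatement, no new mechanism):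
(P1) THE CUT IS STRONGER THAN THE SEED E, NOT WEAKER.  By crit-3's kernel lemma `split_iff_up_to_two`, modulo E½ the load
{U at (t₀, tol), CERT(tol)} is the liminf ⊕ oscillation split of ONE eventual statement EV(t₀) := «eventually in β the box of t₀
half-purity lengths is basin-pure», and {EV(t₀), E½} ⊢ E.  The β-uniformity did not leave the Yang–Mills content; it moved into
U (at precision `tol`) and into the cofinality of CERT.  The only merit of the cut is the DECOUPLING «convergence (U) + value along a
subsequence (CERT)», each half alone strictly weaker than EV(t₀).  (P2) U is now typed at exactly the precision the seam consumes,
`handoverTol = 2⁻²⁵` (the `∀ η` shape-universality of rev 1 was unconsumed decoration; `∀ t` stays because `t₀` is CERT's witness).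
It cannot be made coarse: R contracts only inside its basin (C22: no universal threshold), so any transport by CONVERGENCE must run at
basin precision — the diagnosis that LINE 2 `thermal-ratchet` varies (transport by ORDER has no precision).  (P3) «Reduction to
finite» is NOT achieved in any feasible sense and is no longer claimed: CERT quantifies over an unbounded set of β; one instance at
2⁻²⁵ for SU(2) at β_W = 2.3 is a ratio of Haar integrals over ≈ 10⁸ links to 8 digits; the «effective U ⇒ one certificate» edition
needs L½(β_U) ≳ 6·10³ (O(a²/ℓ²) violations), ≳ 10¹⁷ links (crit-3's numbers, accepted).  (P4) Nothing of YM content to land from this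
line; no prover should be seated on U ∕ CERT ∕ E½.  (P5) see LINE 2 and its card § rev 2.

THE LINE (currency: the cold purity defect `δᶜ_β(L) = coldDefect r.ρ β L = 1 − Z_β(L³×2⌊L/4⌋)/Z_β(L³×⌊L/4⌋)²` of the landed
bridge module; intrinsic ruler: the HALF-PURITY SCALE `L½(β) = halfPurityScale r.ρ β :=` the least `L ≥ 8` with `δᶜ_β(L) ≤ 1/2`,
junk `0` if none):

  IR ⇐ U ∧ CERT ∧ E½ ∧ X_cp ∧ N,  where

* **U = `FSSPointwiseSC`** (finite-size-scaling universality, POINTWISE on the ruler lattice; continuum-limit ∕ uniqueness class —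
  NO gap content): for every integer multiple `t ≥ 1`, the number `δᶜ_β(t·L½(β))` is CAUCHY UP TO `handoverTol = 2⁻²⁵` as `β → ∞`
  (along the couplings where the ruler exists) — rev 2 types U at exactly the precision the seam consumes (rev 1's `∀ η` was
  unconsumed).  It is implied by «`δᶜ_β(t·L½(β))` has a continuum limit `Φ(t)`» and does not say what `Φ(t)` is (a stably impure
  plateau `Φ(t₀) = 0.3` is compatible with U).
* **CERT = `DeepCertificateSC`** (the Yang–Mills content as DECIDABLE INSTANCES): for some `t₀ ≥ 1`, on an UNBOUNDED set of
  couplings `β` (FREQUENTLY, not eventually) the box of `t₀` half-purity lengths is certified deep-pure: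
  `δᶜ_β(t₀·L½(β)) ≤ handoverTol = 2⁻²⁵` (rev 2; rev 1: `1/(32·squaringConst)`).  Each instance is ONE inequality between two Haar
  integrals over finitely many link variables — semi-decidable in principle, infeasible in practice at this depth (P3); no
  uniformity in `β` is asked of the certifier, but the set of instances is unbounded.
* **E½ = `HalfPuritySC`** (the per-β residue, at the SHALLOWEST depth): for all large `β` SOME box `L ≥ 8` is half-pure.
  Strictly weaker BY NAME than the bridge's E = `ColdExitSC` (`halfPurity_of_coldExit`, proved below).
* **X_cp = `ColdPressurePincer.AFToColdPressure`** (asymptotic-freedom pin, shared by name with lines af-pincer ∕ doubling-bridge)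
  and **N = `ColdPressurePincer.IRnsc`** (the `π₁(G) ≠ 1` flux-sector half, the crux restricted; declared residual).

SEAM (PROVED, `coldPressureOnsetSC_of_handover`): «Cauchy + frequently ⇒ eventually».  CERT gives a certified coupling `β⋆`
beyond U's threshold `β_U(t₀)`; U transports the certificate to EVERY `β ≥ β_U` at which the ruler exists
(`δᶜ_β(t₀L½(β)) ≤ 2·handoverTol = 2⁻²⁴`); E½ says the ruler exists for all large `β`; the landed seam
`ColdPurityBridge.coldPressureAt_of_exit_recursion` with the sharp recursion `coldDefect_sq_le_two_pow` turns basin entry into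
`ColdPressureAt r.ρ β (t₀L½(β))`, i.e. `ColdPressureOnsetSC`; `IR_of_cp_repaired` concludes.

WHY THIS LINE (finite lens; rev 2 wording).  Every line on the desk that reaches `IR` carries the infinitely-many-couplings burden
inside ONE per-β-uniform stub (E/H of lines 10/13; OneCertifiedCube's C).  Here that burden is SPLIT, not removed (P1): the
convergence half is U — continuum-limit ∕ universality class, whose proof technology never needs the VALUE of the limit but, as
typed, needs it to precision 2⁻²⁵ — and the value half is CERT, a cofinal family of independent finite certificates, any cofinal
subfamily of which suffices, plus half-purity once per β (E½).  With an EFFECTIVE U, CERT would collapse to ONE certificate at ONE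
coupling — finite but infeasible (P3: ≳ 10¹⁷ links); recorded as the lens's honest ceiling, not as an achievement.

WHY NOVEL vs the listed lines/routes (searched: census v3.1 §L lines 1–15, routes OneCertifiedCube ∕ DoublingDefect ∕ GronwallGap ∕
ComplexCouplingChannel, cards floor-handshake (s2) and MECHANISM-ym-ir-idea-4 (R2)).  Nearest: (a) idea-4's recorded-but-unfiled
re-route (R2) «one certified coupling + RG universality» — declined there as «needs non-perturbative universality at ξ; not R4-class»;
this line TYPES it, in the purity currency where the VOLUME engine R is already a tree theorem, with universality weakened to
pointwise Cauchy-ness of one number and the certificate weakened to FREQUENTLY; (b) floor-handshake's support note (s2) (a JOINT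
two-observable scaling hypothesis ⇒ H) — never typed; this line needs no observable-side scaling and no common ξ(β): the ruler is
intrinsic (self-calibrating); (c) OneCertifiedCube.CrossoverCertificate — TV currency, certificate EVENTUALLY in k, engine F with a
universal threshold; here: free-energy currency, certificate FREQUENTLY, engine R proved.  No listed line uses a universality
statement as the β-transport.  bears_on: R2c (`BalabanLadder.IR`, stmt-QuantumFields-19354).

CHEAPEST FALSIFIER ∕ INSTRUMENT rows (engines ym-ir-eng-*; no kit on this seat): see the card `Lines/fss-handover.md` §7 —
(I11-1) `L½(β)` at `β_W ∈ {2.2,…,2.6}` (SU(2), spectral synthesis from the PORTRAIT: glueball + torelon towers with the `L³`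
phase-space factor; expected `L½(2.5) ≈ 28`, `L½(2.3) ≈ 14`); (I11-2) the WIDTH RATIO `ϑ_tol(β) := L_tol(β)/L½(β)` for
`tol ∈ {10⁻², 10⁻⁴, 2⁻²⁵}` — U predicts `ϑ` FLAT in β up to scaling violations (synthesis: `ϑ_{2⁻²⁵} ≈ 5.4` at both 2.3 and 2.5);
a monotone drift of `ϑ_{2⁻²⁵}` by > 30 % across `β_W ∈ [2.3, 2.6]` kills U-at-depth (or exposes ruler contamination) — informative
either way.  Disproof.lean for 19354: none exists; negatives index (7 entries): none concerns `coldDefect` ∕ FSS statements.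

THE 2²⁰ ∕ 2⁻²⁴ SHARPENING is now THE seam (rev 2): `AspectBootstrap.coldDefect_sq_le_two_pow` landed at 02:30Z
(Theorems/BalabanLadderIRDefectSquaringSharp.lean), so `handoverTol = 2⁻²⁵`, basin `2⁻²⁴`, and `squaringConst` no longer appears.
-/

set_option autoImplicit false

noncomputable section

open Filter Topology MeasureTheory
open Literature.MathematicalPhysics.QuantumFieldTheory Literature.MathematicalPhysics.QuantumLattice
open Literature.MathematicalPhysics.QuantumFieldTheory.Balaban1983to89.Missing (strongCouplingRadius)
open Summit.QuantumFields.YangMills.Cruxes.IR.ColdPurityBridge (coldDefect ColdExitSC ColdDoublingRecursionSC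
  coldPressureAt_of_exit_recursion coldExitSC_strongCoupling coldExit_uniform_of_strongCoupling)
open Summit.QuantumFields.YangMills.Cruxes.IR.ColdPressurePincer (ColdPressureAt AFToColdPressure IRsc IRnsc
  ColdPressureOnsetSC IRsc_of_cp IR_of_cp_repaired)
open Summit.QuantumFields.YangMills.Cruxes.IR.AspectBootstrap (coldDefect_sq_le_two_pow)

namespace Summit.QuantumFields.YangMills.Cruxes.IR.FSSHandover

/-! ## §1 The ruler and the tolerance -/

section Defs

variable {G : Type} [Group G] [TopologicalSpace G] [IsTopologicalGroup G] [CompactSpace G]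
  [MeasurableSpace G] [BorelSpace G]

/-- The **half-purity scale** `L½(β)`: the least lattice size `L ≥ 8` whose cold `4:1` box is half-pure, `δᶜ_β(L) ≤ 1/2`;
junk value `0` if no such box exists (the Prop `HalfPuritySC` says it exists for all large `β`).  The threshold `1/2` is a
CONVENTION fixing the ruler (any fixed `θ ∈ (0,1)` gives an equivalent line); it sits, physically, at the confinement onset of the
`4:1` box (temporal extent `L/4 ≈ 1/T_c`). -/
def halfPurityScale {N : ℕ} (ρ : G →* Matrix (Fin N) (Fin N) ℂ) (β : ℝ) : ℕ :=
  sInf {L : ℕ | 8 ≤ L ∧ coldDefect ρ β L ≤ 1 / 2}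

theorem halfPurityScale_spec {N : ℕ} (ρ : G →* Matrix (Fin N) (Fin N) ℂ) (β : ℝ) (h : 0 < halfPurityScale ρ β) :
    8 ≤ halfPurityScale ρ β ∧ coldDefect ρ β (halfPurityScale ρ β) ≤ 1 / 2 := by
  have hne : {L : ℕ | 8 ≤ L ∧ coldDefect ρ β L ≤ 1 / 2}.Nonempty := by
    by_contra h'
    rw [Set.not_nonempty_iff_eq_empty] at h'
    have h0 : halfPurityScale ρ β = 0 := by
      unfold halfPurityScale
      rw [h', Nat.sInf_empty]
    omega
  exact Nat.sInf_mem hne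

theorem halfPurityScale_pos_of {N : ℕ} (ρ : G →* Matrix (Fin N) (Fin N) ℂ) (β : ℝ) {L : ℕ} (hL : 8 ≤ L)
    (h : coldDefect ρ β L ≤ 1 / 2) : 0 < halfPurityScale ρ β := by
  have hne : {L : ℕ | 8 ≤ L ∧ coldDefect ρ β L ≤ 1 / 2}.Nonempty := ⟨L, hL, h⟩
  have h8 : 8 ≤ sInf {L : ℕ | 8 ≤ L ∧ coldDefect ρ β L ≤ 1 / 2} := (Nat.sInf_mem hne).1
  unfold halfPurityScale
  omega

theorem halfPurityScale_le {N : ℕ} (ρ : G →* Matrix (Fin N) (Fin N) ℂ) (β : ℝ) {L : ℕ} (hL : 8 ≤ L)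
    (h : coldDefect ρ β L ≤ 1 / 2) : halfPurityScale ρ β ≤ L :=
  Nat.sInf_le ⟨hL, h⟩

end Defs

/-- The **hand-over tolerance** `2⁻²⁵` (rev 2: the SHARP landed constant): half the basin threshold `1/(16·max C 2) = 2⁻²⁴` of the
landed seam `coldPressureAt_of_exit_recursion` at the recursion constant `C = 2²⁰` of `AspectBootstrap.coldDefect_sq_le_two_pow`
(Theorems/BalabanLadderIRDefectSquaringSharp.lean; rev 1 used `1/(32·squaringConst)`, `squaringConst = 2·432²·e^{432}`). -/
def handoverTol : ℝ := 1 / 2 ^ 25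

theorem handoverTol_pos : 0 < handoverTol := by
  unfold handoverTol
  positivity

theorem two_mul_handoverTol : handoverTol + handoverTol = 1 / 2 ^ 24 := by
  unfold handoverTol
  norm_num

/-! ## §2 The obligation Props (OPEN; nothing claimed) -/

/-- **U — `FSSPointwiseSC` (crux of the line; continuum-limit ∕ universality class, NO gap content).**  For compact simple
simply-connected `G` and every lattice representation `r`: for every integer `t ≥ 1` there is `β_U` such that for all
`β, β' ≥ β_U` at which the half-purity ruler exists, `|δᶜ_β(t·L½(β)) − δᶜ_{β'}(t·L½(β'))| ≤ handoverTol = 2⁻²⁵` — the purity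
defect of the cold box of `t` half-purity lengths is Cauchy in the coupling UP TO THE SEAM'S PRECISION (rev 2: exactly what
`IR_of` consumes; implied by the existence of a continuum limit `Φ(t)`, value unspecified; rev 1's `∀ η > 0` was unconsumed).
Why it might fail: it is asymptotic scaling ∕ uniqueness of the continuum limit of ONE free-energy ratio at a STRONGLY coupled
physical size (`t·ℓ½ ≳ 1/T_c`) — outside what UV-stability certificates give (`Literature.Barriers.QuantumFields.
UVStabilityNonUniqueness`: stability ⇒ subsequences, not limits); persistent scaling violations of the crossover shape, or an
integer-ruler artefact not dying like `1/L½(β)`, falsify it.  Sources: Luscher1983 (femto universe), PrivmanFisher1983,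
Balaban1988Convergent + Rivasseau1991 III.5 (stability ≠ convergence), JaffeWitten2000 §6 («construction on a compact space would be a
major breakthrough»), deForcrand–Jahn hep-lat/0205024 style FSS of free-energy ratios (numerical universality of Z-ratios). -/
def FSSPointwiseSC : Prop :=
  ∀ (G : Type) [Group G] [TopologicalSpace G] [IsTopologicalGroup G] [CompactSpace G],
    IsCompactSimpleLieGroup G → SimplyConnectedSpace G →
    letI : MeasurableSpace G := borel G
    haveI : BorelSpace G := ⟨rfl⟩
    ∀ r : LatticeRep G, ∀ t : ℕ, 1 ≤ t → ∃ βU : ℝ, ∀ β β' : ℝ, βU ≤ β → βU ≤ β' →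
      0 < halfPurityScale r.ρ β → 0 < halfPurityScale r.ρ β' →
        |coldDefect r.ρ β (t * halfPurityScale r.ρ β) - coldDefect r.ρ β' (t * halfPurityScale r.ρ β')| ≤ handoverTol

/-- **CERT — `DeepCertificateSC` (the Yang–Mills content as decidable instances; crux of the line).**  For compact simple
simply-connected `G` and every `r` there is a width `t₀ ≥ 1` such that FREQUENTLY in `β` (on an unbounded set of couplings — NOT
eventually) the ruler exists and the box of `t₀` half-purity lengths is certified deep-pure: `δᶜ_β(t₀·L½(β)) ≤ handoverTol`.
Each instance is ONE inequality between Haar integrals over the finitely many links of two tori (`(t₀L½)³ × t₀L½/2` and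
`(t₀L½)³ × t₀L½/4`); no uniformity in `β` is asked.  Why it might fail: the crossover WIDTH `L_deep(β)/L½(β)` could be unbounded
along every cofinal set of couplings (confinement setting in parametrically later than half-purity) — then no `t₀` works; and no
rigorous producer of a single instance exists beyond the strong-coupling window (box side `≍ 5·L½(β⋆) ≈ 70–150` sites at
`β_W ∈ [2.3, 2.5]` for `SU(2)`, tolerance `2⁻²⁵` in the sharpened constant: «THE NUMBER» of the desk).  Sources: Luscher1986,
vanBaalKoller1987, Teper1998 (hep-th/9812187, SU(2) spectra), `pub/ym-ir/REDUCTION-CENSUS.md` B7/B15, card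
finite-size-criterion-crossover (route OneCertifiedCube). -/
def DeepCertificateSC : Prop :=
  ∀ (G : Type) [Group G] [TopologicalSpace G] [IsTopologicalGroup G] [CompactSpace G],
    IsCompactSimpleLieGroup G → SimplyConnectedSpace G →
    letI : MeasurableSpace G := borel G
    haveI : BorelSpace G := ⟨rfl⟩
    ∀ r : LatticeRep G, ∃ t₀ : ℕ, 1 ≤ t₀ ∧ ∀ β₁ : ℝ, ∃ β : ℝ, β₁ ≤ β ∧ 0 < halfPurityScale r.ρ β ∧
      coldDefect r.ρ β (t₀ * halfPurityScale r.ρ β) ≤ handoverTol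

/-- **E½ — `HalfPuritySC` (the per-β residue at the shallowest depth; crux of the line).**  For compact simple simply-connected
`G` and every `r` there is `β½` such that for every `β ≥ β½` SOME cold box `L ≥ 8` is half-pure, `δᶜ_β(L) ≤ 1/2` (equivalently:
the ruler `L½(β)` exists).  Strictly weaker by name than the bridge's `ColdExitSC` (`halfPurity_of_coldExit`).  Why it might fail:
it is «not massless at β» once per weak coupling — false for `U(1)₄` (Coulomb phase: `δᶜ ≥ 1 − e^{−26}` at every size,
`Literature.Barriers.QuantumFields.AbelianDeconfinementD4`), open for `SU(2)` beyond the strong-coupling window; a proof must use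
non-abelianness.  Sources: Guth1980 ∕ FrohlichSpencer1982 (U(1)₄), OsterwalderSeiler1978 (strong coupling), Luscher1977. -/
def HalfPuritySC : Prop :=
  ∀ (G : Type) [Group G] [TopologicalSpace G] [IsTopologicalGroup G] [CompactSpace G],
    IsCompactSimpleLieGroup G → SimplyConnectedSpace G →
    letI : MeasurableSpace G := borel G
    haveI : BorelSpace G := ⟨rfl⟩
    ∀ r : LatticeRep G, ∃ β₁ : ℝ, ∀ β : ℝ, β₁ ≤ β → ∃ L : ℕ, 8 ≤ L ∧ coldDefect r.ρ β L ≤ 1 / 2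

/-! ## §3 Seams, PROVED -/

section Seam

variable {G : Type} [Group G] [TopologicalSpace G] [IsTopologicalGroup G] [CompactSpace G]
  [MeasurableSpace G] [BorelSpace G]

/-- **Basin entry ⇒ cold pressure at the SHARP tree constant `C = 2²⁰`** (rev 2, crit-3 P3): `δᶜ_β(L) ≤ 2⁻²⁴` at some `L ≥ 8`,
`β ≥ 0`, gives `ColdPressureAt r.ρ β L` — the landed seam `coldPressureAt_of_exit_recursion` fed with the landed unconditional recursion
`AspectBootstrap.coldDefect_sq_le_two_pow` (`δᶜ_β(L') ≤ 2²⁰·δᶜ_β(L)²`, any compact `G`, `β ≥ 0`, `L ≥ 8`, `L' ∈ [2L, 4L]`). -/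
theorem coldPressureAt_of_le (r : LatticeRep G) {β : ℝ} (hβ : 0 ≤ β) {L : ℕ} (hL : 8 ≤ L)
    (h : coldDefect r.ρ β L ≤ 1 / 2 ^ 24) : ColdPressureAt r.ρ β L := by
  have hmax : max ((2 : ℝ) ^ 20) 2 = 2 ^ 20 := max_eq_left (by norm_num)
  refine coldPressureAt_of_exit_recursion r hβ (C := (2 : ℝ) ^ 20) (by positivity) (L₀ := 8)
    (fun L hL L' h₁ h₂ => coldDefect_sq_le_two_pow r hβ L hL L' h₁ h₂) (by rw [max_self]; exact hL) ?_
  rw [hmax]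
  have : (1 : ℝ) / (16 * 2 ^ 20) = 1 / 2 ^ 24 := by norm_num
  rw [this]
  exact h

/-- **The finite-lens seam, abstract form: «Cauchy + one certificate beyond the threshold ⇒ small everywhere beyond it».** -/
theorem le_add_of_cauchy_cert (f : ℝ → ℝ) (P : ℝ → Prop) {η θ βU : ℝ}
    (hU : ∀ β β' : ℝ, βU ≤ β → βU ≤ β' → P β → P β' → |f β - f β'| ≤ η)
    (hC : ∃ β : ℝ, βU ≤ β ∧ P β ∧ f β ≤ θ) :
    ∀ β : ℝ, βU ≤ β → P β → f β ≤ θ + η := by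
  obtain ⟨βs, hs, hPs, hfs⟩ := hC
  intro β hβ hP
  have h := (abs_sub_le_iff.1 (hU β βs hβ hs hP hPs)).1
  linarith

end Seam

/-- **E½ is weaker than E by name**: `ColdExitSC → HalfPuritySC` (take `ε = 1/2`, `L₀ = 8`). -/
theorem halfPurity_of_coldExit (hE : ColdExitSC) : HalfPuritySC := by
  intro G _ _ _ _ hG hsc
  letI : MeasurableSpace G := borel G
  haveI : BorelSpace G := ⟨rfl⟩
  intro r
  obtain ⟨β₁, hβ₁⟩ := hE G hG hsc r (1 / 2) (by norm_num)
  exact ⟨β₁, fun β hβ => hβ₁ β hβ 8⟩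

/-- **THE SEAM (PROVED): U ∧ CERT ∧ E½ ⇒ `ColdPressureOnsetSC`.**  Per `(G, r)`: CERT gives the width `t₀`; U at
`t₀` gives `β_U`; CERT gives a certified `β⋆ ≥ β_U`; for `β ≥ max β_U (max β½ 0)` the ruler exists (E½), the
abstract seam gives `δᶜ_β(t₀L½(β)) ≤ 2·handoverTol = 2⁻²⁴`, and `coldPressureAt_of_le` gives cold pressure with
length `t₀·L½(β) ≥ 8 ≥ 1`. -/
theorem coldPressureOnsetSC_of_handover (hU : FSSPointwiseSC) (hC : DeepCertificateSC) (hE : HalfPuritySC) :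
    ColdPressureOnsetSC := by
  intro G _ _ _ _ hG hsc
  letI : MeasurableSpace G := borel G
  haveI : BorelSpace G := ⟨rfl⟩
  intro r
  obtain ⟨t₀, ht₀, hcert⟩ := hC G hG hsc r
  obtain ⟨βU, hβU⟩ := hU G hG hsc r t₀ ht₀
  obtain ⟨βh, hβh⟩ := hE G hG hsc r
  have hsmall := le_add_of_cauchy_cert
    (fun β => coldDefect r.ρ β (t₀ * halfPurityScale r.ρ β)) (fun β => 0 < halfPurityScale r.ρ β) hβU
    (by obtain ⟨βs, h1, h2, h3⟩ := hcert βU; exact ⟨βs, h1, h2, h3⟩)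
  refine ⟨max βU (max βh 0), fun β hβ => ?_⟩
  have hβU' : βU ≤ β := le_trans (le_max_left _ _) hβ
  have hβh' : βh ≤ β := le_trans ((le_max_left _ _).trans (le_max_right _ _)) hβ
  have hβ0 : 0 ≤ β := le_trans ((le_max_right _ _).trans (le_max_right _ _)) hβ
  obtain ⟨L, hL8, hLδ⟩ := hβh β hβh'
  have hpos : 0 < halfPurityScale r.ρ β := halfPurityScale_pos_of r.ρ β hL8 hLδ
  have h8 : 8 ≤ halfPurityScale r.ρ β := (halfPurityScale_spec r.ρ β hpos).1
  have hbig : 8 ≤ t₀ * halfPurityScale r.ρ β := le_trans h8 (Nat.le_mul_of_pos_left _ ht₀)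
  have hδ : coldDefect r.ρ β (t₀ * halfPurityScale r.ρ β) ≤ 1 / 2 ^ 24 := by
    rw [← two_mul_handoverTol]
    exact hsmall β hβU' hpos
  exact ⟨t₀ * halfPurityScale r.ρ β, le_trans (by norm_num) hbig, coldPressureAt_of_le r hβ0 hbig hδ⟩

/-- **U ∧ CERT ∧ E½ ∧ X_cp ⇒ `IRsc`** (the simply-connected half; `ColdPressurePincer.IRsc_of_cp`). -/
theorem IRsc_of_handover (hU : FSSPointwiseSC) (hC : DeepCertificateSC) (hE : HalfPuritySC) (hX : AFToColdPressure) :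
    IRsc :=
  IRsc_of_cp (coldPressureOnsetSC_of_handover hU hC hE) hX

/-- **The line concludes the crux `IR` BY NAME** from the five obligations (`ColdPressurePincer.IR_of_cp_repaired`).
Kernel-checked, no sorry. -/
theorem IR_of : FSSPointwiseSC → DeepCertificateSC → HalfPuritySC → AFToColdPressure → IRnsc →
    Summit.QuantumFields.YangMills.Theses.BalabanLadder.IR :=
  fun hU hC hE hX hN => IR_of_cp_repaired (coldPressureOnsetSC_of_handover hU hC hE) hX hN

/-! ## §4 Rungs (PROVED; strong-coupling window — non-vacuity of the currency, honestly INSIDE the known regime) -/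

section Rungs

variable {G : Type} [Group G] [TopologicalSpace G] [IsTopologicalGroup G] [CompactSpace G]
  [MeasurableSpace G] [BorelSpace G]

/-- **Rung for E½**: on `0 ≤ β ≤ strongCouplingRadius r.ρ` the ruler exists (every compact `G`, every `r`). -/
theorem halfPurity_strongCoupling (r : LatticeRep G) {β : ℝ} (hβ0 : 0 ≤ β) (hβ : β ≤ strongCouplingRadius r.ρ) :
    0 < halfPurityScale r.ρ β := by
  obtain ⟨L, hL, h⟩ := coldExitSC_strongCoupling r hβ0 hβ (ε := 1 / 2) (by norm_num) 8
  exact halfPurityScale_pos_of r.ρ β hL h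

/-- **Rung for CERT (body only)**: ONE width `t₀` certifies the box of `t₀` half-purity lengths at EVERY coupling of the
strong-coupling window (uniform strong-coupling exit at tolerance `handoverTol`, boxes `8k`, `k ≥ k₁`; `t₀ := 8k₁`). -/
theorem deepCertificate_body_strongCoupling (r : LatticeRep G) :
    ∃ t₀ : ℕ, 1 ≤ t₀ ∧ ∀ β : ℝ, 0 ≤ β → β ≤ strongCouplingRadius r.ρ →
      0 < halfPurityScale r.ρ β ∧ coldDefect r.ρ β (t₀ * halfPurityScale r.ρ β) ≤ handoverTol := by
  obtain ⟨k₁, hk₁, h⟩ := coldExit_uniform_of_strongCoupling r handoverTol_pos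
  refine ⟨8 * k₁, by omega, fun β hβ0 hβ => ?_⟩
  have hpos := halfPurity_strongCoupling r hβ0 hβ
  refine ⟨hpos, ?_⟩
  have hk : k₁ ≤ k₁ * halfPurityScale r.ρ β := Nat.le_mul_of_pos_right _ hpos
  have := h β hβ0 hβ (k₁ * halfPurityScale r.ρ β) hk
  simpa [Nat.mul_assoc] using this

end Rungs

/-! ## §5 Registered stubs (the obligations of the line; `sorry` ONLY here) and the composition by name -/

/-- stub U — finite-size-scaling universality, pointwise on the half-purity ruler (continuum-limit class). -/
theorem stub_fssPointwise : FSSPointwiseSC := by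
  sorry

/-- stub CERT — deep purity certified FREQUENTLY at bounded width (decidable instances). -/
theorem stub_deepCertificate : DeepCertificateSC := by
  sorry

/-- stub E½ — half-purity once per weak coupling (the per-β residue). -/
theorem stub_halfPurity : HalfPuritySC := by
  sorry

/-- stub X_cp — the asymptotic-freedom pin of the pincer, BY NAME (shared with af-pincer ∕ doubling-bridge). -/
theorem stub_afPin : AFToColdPressure := by
  sorry

/-- stub N — the `π₁(G) ≠ 1` flux-sector half of the crux, BY NAME (declared residual). -/
theorem stub_irnsc : IRnsc := by
  sorry

/-- The crux by name from the registered stubs. -/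
theorem IR_of_stubs : Summit.QuantumFields.YangMills.Theses.BalabanLadder.IR :=
  IR_of stub_fssPointwise stub_deepCertificate stub_halfPurity stub_afPin stub_irnsc

end Summit.QuantumFields.YangMills.Cruxes.IR.FSSHandover

end
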